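import Literature.AlgebraicGeometry.HodgeTheory.SimpleAbelianSevenfoldHodgeClasses
import Literature.AlgebraicGeometry.HodgeTheory.RibetTypeThreeCoprimePowersHodgeClasses
import HarnessLib

/-!
# Simple complex abelian varieties of odd prime dimension `p`: `B•(Xⁿ) = D•(Xⁿ)` outside the generic shape `End⁰ = ℚ` and the unitary shapes with both multiplicities `≥ 4` — the case `p = 7`: the Hodge conjecture for all powers of EVERY simple sevenfold with `End⁰ ≠ ℚ` (Tankeev–Ribet; Ribet 1983 Thm. 3 at `(3, p − 3)`; Moonen–Zarhin 1999 Thm. (2.7))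

Family `hodge`, layer `Literature/AlgebraicGeometry/HodgeTheory`. Research context: cell `pub-hodge-ring2` (HONEST
FRAMING: research route conditional on HC_CM; not a corollary; Q11.4-sentence-2 already refuted in dim ≥ 3), Literature
lane (lit gen 83, programme R62). Theorems only (no definition, no named fact, D-0026; nothing admitted). Sequel of the
tree's `SimpleAbelianSevenfoldHodgeClasses` (lit gen 83, programme R61: residual shapes (S1) `End⁰ = ℚ` and (S2′) unitary
with both multiplicities `≥ 3`; for `p = 7` the single residual signature pair `(3,4)`/`(4,3)`): with the tree's
UNCONDITIONAL `AbelianVariety.isDivisorGenerated_powSucc_of_ribetTypeThreeCoprime` (Ribet's Thm. 3 at multiplicities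
`(3, p − 3)`, `3 ∤ p` — `RibetTypeThreeCoprimePowersHodgeClasses`, resting on the Hermitian core `UnitaryThreeCoprime.eq_top`)
the shape (S2′) shrinks to (S2″): both multiplicities `≥ 4`; for `p = 7` NO unitary shape is left, so the only simple
sevenfolds not covered are those with `End⁰(X) = ℚ` (`Hg = Sp₁₄`, Tankeev).

PRINTED RESULTS. Moonen–Zarhin, Math. Ann. 315 (1999), Thm. (2.7): «Let `X` be a simple complex abelian variety such that
`dim(X)` is a prime number. Then `Hg(X) = Sp_D(V,φ)` and `B•(Xⁿ) = D•(Xⁿ)` for every `n ≥ 1`» (Tankeev; Ribet). Gordon,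
*Survey*, Thm. 6.3 (Ribet 1983 Thms. 1–3) and its Corollary (prime dimension).

THIS FILE.
* §1 **`isDivisorGenerated_powSucc_of_isSimple_of_prime_of_odd_of_ge_four`** — `B•(X^{N+1}) = D•(X^{N+1})` for `X`
  simple of odd prime dimension GRANTED (S1) and (S2″) as pointwise hypotheses;
  `tankeevRibet1983_iff_generic_and_unitary_ge_four` — the Tankeev–Ribet named fact is EQUIVALENT to (S1) ∧ (S2″).
* §2 `p = 7`: **`isDivisorGenerated_powSucc_of_isSimple_sevenfold_of_generic`** (granted (S1) only),
  **`hodgeConjectureFor_powSucc_of_isSimple_sevenfold_of_finrank_ne_one`** — THE HODGE CONJECTURE FOR ALL POWERS OF EVERY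
  SIMPLE COMPLEX ABELIAN SEVENFOLD whose endomorphism algebra is not `ℚ`, UNCONDITIONAL; and the hypothesis-free unitary
  cell `AbelianVariety.isDivisorGenerated_powSucc_of_sevenfold_unitary` (any signature with both multiplicities positive).
NOT claimed: the shape (S1) (`End⁰ = ℚ`, `Hg = Sp₁₄`).

## References
* [MoonenZarhin1999LowDim] B. Moonen, Yu. Zarhin, Math. Ann. 315 (1999), §2 (2.4) and Thm. (2.7).
* [Gordon1997] B. B. Gordon, *A survey of the Hodge conjecture for abelian varieties*, Thm. 6.3 and Corollary, §1.13.3.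
* [Ribet1983] K. A. Ribet, Amer. J. Math. 105 (1983), Thms. 0–3.
* [Pohlmann1968] H. Pohlmann, Ann. of Math. 88 (1968), Thm. 1.
* [vanGeemen1994HodgeAV] B. van Geemen, LNM 1594 (1994), §2.4.
* [Deligne2000] P. Deligne, *The Hodge conjecture* (Clay problem statement), §1.
-/

noncomputable section

open CategoryTheory Module NumberField

namespace Literature.AlgebraicGeometry.HodgeTheory

open Literature.AlgebraicGeometry.Motives Literature.AlgebraicGeometry.ComplexMultiplication
open Literature.Barriers.HodgeConjecture (divisorClassesSpan)

variable {X : AbelianVariety ℂ}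

/-! ### §1 Odd prime dimension: the unitary residual shape shrinks to multiplicities `≥ 4` -/

/-- **`B•(X^{N+1}) = D•(X^{N+1})` for `X` simple of odd prime dimension, GRANTED (S1) `End⁰ = ℚ` and (S2″) the unitary
shape with BOTH multiplicities `≥ 4`** (pointwise hypotheses `h1`, `h4`). A multiplicity equal to `3` in prime dimension
`p ≥ 7` (`3 ∤ p`) is the tree's unconditional `AbelianVariety.isDivisorGenerated_powSucc_of_ribetTypeThreeCoprime`; the
other shapes as in `isDivisorGenerated_powSucc_of_isSimple_of_prime_of_odd_of_ge_three`.
[cite: MoonenZarhin1999LowDim, §2 (2.4) and Thm. (2.7)] [cite: Gordon1997, Thm. 6.3 and Corollary] [cite: Ribet1983, Thms. 0–3]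
[cite: Pohlmann1968, Thm. 1] -/
theorem isDivisorGenerated_powSucc_of_isSimple_of_prime_of_odd_of_ge_four (hs : X.IsSimple) (hp : X.dim.Prime)
    (hodd : Odd X.dim)
    (h1 : Module.finrank ℚ X.endAlgebra = 1 → ∀ N : ℕ, IsDivisorGenerated (X.powSucc N))
    (h4 : ∀ (φ : X ⟶ X) (d : ℕ), 0 < d → φ ≫ φ = -(d • 𝟙 X) → Module.finrank ℚ X.endAlgebra = 2 →
      4 ≤ eigenMultiplicity X φ (Complex.I * (Real.sqrt d : ℂ)) →
      4 ≤ eigenMultiplicity X φ (-(Complex.I * (Real.sqrt d : ℂ))) → ∀ N : ℕ, IsDivisorGenerated (X.powSucc N))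
    (N : ℕ) : IsDivisorGenerated (X.powSucc N) := by
  classical
  refine isDivisorGenerated_powSucc_of_isSimple_of_prime_of_odd_of_ge_three hs hp hodd h1
    (fun φ d hd hφ he2 ha hb N => ?_) N
  have hsum := eigenMultiplicity_add_eigenMultiplicity_neg_eq_dim X φ hd hφ
  by_cases hthree : eigenMultiplicity X φ (Complex.I * (Real.sqrt d : ℂ)) = 3 ∨
      eigenMultiplicity X φ (-(Complex.I * (Real.sqrt d : ℂ))) = 3
  · -- `dim X = n′ + n″ ≥ 6` is prime, hence `≠ 3`, hence `3 ∤ dim X`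
    have h3dim : ¬ 3 ∣ X.dim := fun h => by
      have := (Nat.prime_dvd_prime_iff_eq Nat.prime_three hp).1 h
      omega
    exact AbelianVariety.isDivisorGenerated_powSucc_of_ribetTypeThreeCoprime X φ hd hφ he2 h3dim hthree N
  · simp only [not_or] at hthree
    exact h4 φ d hd hφ he2 (by omega) (by omega) N

/-- **LOCALISATION OF THE TANKEEV–RIBET FACT, SHARPENED AGAIN.** The tree's named fact
`TankeevRibet1983_hodgeClasses_divisorial_powers_simplePrimeDimension` is EQUIVALENT to the conjunction of (S1) simple `X`
of odd prime dimension with `End⁰(X) = ℚ`, and (S2″) simple `X` of prime dimension with `dim_ℚ End⁰(X) = 2`, `φ ≫ φ = -d`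
and BOTH multiplicities `≥ 4` (the tree's `tankeevRibet1983_iff_generic_and_unitary_ge_three` with (S2′) narrowed by
`AbelianVariety.isDivisorGenerated_powSucc_of_ribetTypeThreeCoprime`). [cite: MoonenZarhin1999LowDim, §2 Thm. (2.7)]
[cite: Gordon1997, Thm. 6.3 and Corollary] [cite: Ribet1983, Thms. 1 and 3] -/
theorem tankeevRibet1983_iff_generic_and_unitary_ge_four :
    TankeevRibet1983_hodgeClasses_divisorial_powers_simplePrimeDimension ↔
      (∀ X : AbelianVariety ℂ, X.dim.Prime → Odd X.dim → X.IsSimple → Module.finrank ℚ X.endAlgebra = 1 →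
        ∀ N : ℕ, IsDivisorGenerated (X.powSucc N)) ∧
      (∀ (X : AbelianVariety ℂ) (φ : X ⟶ X) (d : ℕ), X.dim.Prime → X.IsSimple → 0 < d → φ ≫ φ = -(d • 𝟙 X) →
        Module.finrank ℚ X.endAlgebra = 2 → 4 ≤ eigenMultiplicity X φ (Complex.I * (Real.sqrt d : ℂ)) →
        4 ≤ eigenMultiplicity X φ (-(Complex.I * (Real.sqrt d : ℂ))) → ∀ N : ℕ, IsDivisorGenerated (X.powSucc N)) := by
  rw [tankeevRibet1983_iff_generic_and_unitary_ge_three]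
  refine ⟨fun ⟨hS1, hS3⟩ => ⟨hS1, fun X φ d hp hs hd hφ he2 ha hb N =>
    hS3 X φ d hp hs hd hφ he2 (by omega) (by omega) N⟩, fun ⟨hS1, hS4⟩ => ⟨hS1, ?_⟩⟩
  intro X φ d hp hs hd hφ he2 ha hb N
  have hsum := eigenMultiplicity_add_eigenMultiplicity_neg_eq_dim X φ hd hφ
  by_cases hthree : eigenMultiplicity X φ (Complex.I * (Real.sqrt d : ℂ)) = 3 ∨
      eigenMultiplicity X φ (-(Complex.I * (Real.sqrt d : ℂ))) = 3
  · have h3dim : ¬ 3 ∣ X.dim := fun h => by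
      have := (Nat.prime_dvd_prime_iff_eq Nat.prime_three hp).1 h
      omega
    exact AbelianVariety.isDivisorGenerated_powSucc_of_ribetTypeThreeCoprime X φ hd hφ he2 h3dim hthree N
  · simp only [not_or] at hthree
    exact hS4 X φ d hp hs hd hφ he2 (by omega) (by omega) N

/-! ### §2 Dimension seven: every simple abelian sevenfold except `End⁰ = ℚ` -/

/-- **`B•(X^{N+1}) = D•(X^{N+1})` for every SIMPLE complex abelian SEVENFOLD, GRANTED ONLY the generic shape `End⁰(X) = ℚ`
(hypothesis `h1`)**: the unitary signatures `(1,6)`/`(6,1)` are the tree's type-one theorem, `(2,5)`/`(5,2)` the tree's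
`AbelianVariety.isDivisorGenerated_powSucc_of_sevenfold_twoFive`, `(3,4)`/`(4,3)` the tree's
`AbelianVariety.isDivisorGenerated_powSucc_of_sevenfold_threeFour`; the totally real degree-`7` and CM shapes as in
`SimpleOddPrimeDimensionHodgeClasses`. [cite: MoonenZarhin1999LowDim, §2 (2.4) and Thm. (2.7)] [cite: Ribet1983, Thms. 0–3]
[cite: Pohlmann1968, Thm. 1] -/
theorem isDivisorGenerated_powSucc_of_isSimple_sevenfold_of_generic (hs : X.IsSimple) (hX7 : X.dim = 7)
    (h1 : Module.finrank ℚ X.endAlgebra = 1 → ∀ N : ℕ, IsDivisorGenerated (X.powSucc N)) (N : ℕ) :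
    IsDivisorGenerated (X.powSucc N) := by
  refine isDivisorGenerated_powSucc_of_isSimple_sevenfold hs hX7 h1 (fun φ d hd hφ he2 ha hb N => ?_) N
  have hsum := eigenMultiplicity_add_eigenMultiplicity_neg_eq_dim X φ hd hφ
  have hthree : eigenMultiplicity X φ (Complex.I * (Real.sqrt d : ℂ)) = 3 ∨
      eigenMultiplicity X φ (-(Complex.I * (Real.sqrt d : ℂ))) = 3 := by omega
  exact AbelianVariety.isDivisorGenerated_powSucc_of_sevenfold_threeFour X φ hd hφ he2 hX7 hthree N

/-- **THE HODGE CONJECTURE FOR ALL POWERS OF EVERY SIMPLE COMPLEX ABELIAN SEVENFOLD WITH `End⁰(X) ≠ ℚ` — UNCONDITIONAL**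
(`B = D` on the powers by the previous theorem, then Lefschetz `(1,1)` via the tree's
`hodgeConjectureFor_of_isDivisorGenerated`). The only simple sevenfolds not covered are those with `End⁰(X) = ℚ`
(Moonen–Zarhin (2.7): `Hg = Sp₁₄`, Tankeev), recorded by the hypothesis `hne`.
[cite: MoonenZarhin1999LowDim, §2 Thm. (2.7)] [cite: Ribet1983, Thms. 0–3] [cite: vanGeemen1994HodgeAV, §2.4]
[cite: Deligne2000, §1] -/
theorem hodgeConjectureFor_powSucc_of_isSimple_sevenfold_of_finrank_ne_one (hs : X.IsSimple) (hX7 : X.dim = 7)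
    (hne : Module.finrank ℚ X.endAlgebra ≠ 1) (N : ℕ) :
    HodgeConjectureFor (X.powSucc N).dim (X.powSucc N).X :=
  hodgeConjectureFor_of_isDivisorGenerated _
    (isDivisorGenerated_powSucc_of_isSimple_sevenfold_of_generic hs hX7 (fun h => absurd h hne) N)

/-- **`B = D` on all powers of EVERY complex abelian sevenfold of unitary type `φ ≫ φ = -d`, `dim_ℚ End⁰ = 2`, with both
multiplicities positive — every signature `(1,6)`, `(2,5)`, `(3,4)`, `(4,3)`, `(5,2)`, `(6,1)`** — UNCONDITIONAL,
hypothesis-free form (`X` need not be simple). [cite: Ribet1983, Thm. 3] [cite: MoonenZarhin1999LowDim, §2 Thm. (2.7)]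
[cite: Gordon1997, Thm. 6.3 (3)] -/
theorem AbelianVariety.isDivisorGenerated_powSucc_of_sevenfold_unitary (X : AbelianVariety ℂ) (φ : X ⟶ X)
    {d : ℕ} (hd : 0 < d) (hφ : φ ≫ φ = -(d • 𝟙 X)) (hE2 : Module.finrank ℚ X.endAlgebra = 2) (hX7 : X.dim = 7)
    (hpos : 0 < eigenMultiplicity X φ (Complex.I * (Real.sqrt d : ℂ)) ∧
      0 < eigenMultiplicity X φ (-(Complex.I * (Real.sqrt d : ℂ)))) (N : ℕ) :
    IsDivisorGenerated (X.powSucc N) := by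
  have hsum := eigenMultiplicity_add_eigenMultiplicity_neg_eq_dim X φ hd hφ
  by_cases hle : eigenMultiplicity X φ (Complex.I * (Real.sqrt d : ℂ)) ≤ 2 ∨
      eigenMultiplicity X φ (-(Complex.I * (Real.sqrt d : ℂ))) ≤ 2
  · exact AbelianVariety.isDivisorGenerated_powSucc_of_sevenfold_unitary_le_two X φ hd hφ hE2 hX7 hle hpos N
  · simp only [not_or, not_le] at hle
    have hthree : eigenMultiplicity X φ (Complex.I * (Real.sqrt d : ℂ)) = 3 ∨
        eigenMultiplicity X φ (-(Complex.I * (Real.sqrt d : ℂ))) = 3 := by omega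
    exact AbelianVariety.isDivisorGenerated_powSucc_of_sevenfold_threeFour X φ hd hφ hE2 hX7 hthree N

/-- **The Hodge conjecture for all powers of every complex abelian sevenfold of unitary type (any signature, both
multiplicities positive) — UNCONDITIONAL.** [cite: Ribet1983, Thm. 3] [cite: MoonenZarhin1999LowDim, §2 Thm. (2.7)]
[cite: Deligne2000, §1] -/
theorem hodgeConjectureFor_powSucc_of_sevenfold_unitary (X : AbelianVariety ℂ) (φ : X ⟶ X)
    {d : ℕ} (hd : 0 < d) (hφ : φ ≫ φ = -(d • 𝟙 X)) (hE2 : Module.finrank ℚ X.endAlgebra = 2) (hX7 : X.dim = 7)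
    (hpos : 0 < eigenMultiplicity X φ (Complex.I * (Real.sqrt d : ℂ)) ∧
      0 < eigenMultiplicity X φ (-(Complex.I * (Real.sqrt d : ℂ)))) (N : ℕ) :
    HodgeConjectureFor (X.powSucc N).dim (X.powSucc N).X :=
  hodgeConjectureFor_of_isDivisorGenerated _
    (AbelianVariety.isDivisorGenerated_powSucc_of_sevenfold_unitary X φ hd hφ hE2 hX7 hpos N)

end Literature.AlgebraicGeometry.HodgeTheory

end
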